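import Summits.BirchSwinnertonDyer.Rank1Residual.X11a.ChainBounded
import Summits.BirchSwinnertonDyer.Rank1Residual.X11a.ChainMTT
import HarnessLib

/-!
# Class X11a: the image-free and MTT-discharged forms of the chain, on the PRINT-FAITHFUL (BOUNDED)
# Wan / EPW facts (2026-08-20 repair; successors of `ChainNotDvd`, `ChainLargePrime`, `ChainMTT`)

HONEST FRAMING (run/shared/lean/b2b/bsd-rank1-residual/, verbatim in every file): the goal of the
cell is to DELETE the COMBINATION-SHAPED residual classes of the Birch–Swinnerton-Dyer formula for
ALL analytic-rank `≤ 1` elliptic curves over `ℚ` — "full BSD formula for every rank `≤ 1` curve in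
class `C`" assembled STRICTLY from published theorems — so that the rank-`≤ 1` remainder becomes
exactly the CONSTRUCTION-SHAPED classes, which are TYPED (missing-input `Prop`s), NOT attempted.
This is not "finishing BSD". Research route; NO CLAIM BEYOND STATED CLASSES. Theorems only; no new
definition, no new fact; no label change (cell lead / referee).

WHY (see `X11a/ChainBounded.lean`): the chain's binders `hT2 : Wan2015.thm4_rational_weightK_member`
and `hT1b : EmertonPollackWeston2006.thm513_transfer_from_weightK_member` were mis-quantified (every
interpolant `L` with the bare predicate `IsCycPAdicLFunctionWeightK`, which `L ↦ L + log(1+T)`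
preserves while destroying boundedness — so the Wan fact is false as typed and the chain theorems
held vacuously in `hT2`; finding of the `lit-su` seat, SU2014-TYPING.md §5/§8, verified by harvest-2).
The corrected facts `…_of_bdd` (p239712 / p239784) carry the boundedness binder that
`exists_isCycPAdicLFunctionWeightK` delivers; the gate's append-only rule keeps the originals in
place (DEPRECATED, to be removed with the two retired facts once unreferenced), so the successors
live in sibling modules: `ChainBounded` (discharge + class level), this file, and its sequel.

CONTENT — successors, same statements with the two corrected binders (hence WEAKER hypotheses), same
one-line proofs over `X11a.forall_bsdp_of_namedFacts_bdd`:
* `forall_bsdp_of_namedFacts_bdd_of_not_dvd` (← `ChainNotDvd.forall_bsdp_of_namedFacts_of_not_dvd`: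
  `Surj` from the integer check `p ∤ ord_p Δ_min`, Serre 1972 §1.12 / §2.4),
* `forall_bsdp_of_namedFacts_bdd_of_eleven_le` (← `ChainLargePrime.…_of_eleven_le`: `Surj` from
  BDMTV 2019 Thm. 1.2 at `p ≥ 11`),
* `forall_bsdp_of_namedFacts_bdd_mtt`, `…_bdd_mtt_of_eleven_le`, `…_bdd_mtt_of_not_dvd`
  (← `ChainMTT`: the Mazur–Tate–Teitelbaum existence binder supplied by the tree theorem
  `exists_isCycPAdicLFunctionWeightK_holds`).

References: as in `X11a/ChainBounded.lean`, `ChainNotDvd.lean`, `ChainLargePrime.lean`, `ChainMTT.lean`.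
-/

noncomputable section

open scoped Classical MatrixGroups ModularForm

open CongruenceSubgroup WeierstrassCurve Literature.NumberTheory.EllipticCurves
  Literature.NumberTheory.EllipticCurves.ModularForms
  Literature.NumberTheory.EllipticCurves.Rank1Residual
  Literature.NumberTheory.EllipticCurves.Rank1Residual.Typed
  Literature.NumberTheory.EllipticCurves.Wuthrich2014
  Literature.NumberTheory.EllipticCurves.SteinWuthrich2013
  Literature.NumberTheory.EllipticCurves.GreenbergVatsal2000
  Literature.NumberTheory.EllipticCurves.EmertonPollackWeston2006
  Literature.NumberTheory.EllipticCurves.BalakrishnanEtAl2019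
  Summit.BirchSwinnertonDyer.Rank1Residual.X1.MuLambda
  Summit.BirchSwinnertonDyer.Rank1Residual.X11a.LambdaNorm

set_option autoImplicit false

namespace Summit.BirchSwinnertonDyer.Rank1Residual.X11a

open Chain

/-- (Successor of `forall_bsdp_of_namedFacts_of_not_dvd` on the print-faithful BOUNDED Wan / EPW facts —
2026-08-20 repair; same proof.)
**X11a ∩ {`p ≥ 5`, `p ∤ ord_p(Δ_min)`}: `BSD(E,p)` ⇐ NAMED PUBLISHED FACTS + the per-pair
certificate `μ^an(E,p) = 0`, with NO hypothesis on the image of `ρ̄_{E,p}`** — x11a's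
`forall_bsdp_of_namedFacts_bdd` with its `Surj W p` binder supplied by `ClassX11a.surj_of_not_dvd`
(at an odd multiplicative `p` with `E[p]` irreducible and `p ∤ ord_p Δ_min`, `ρ̄_{E,p}` is onto —
tree theorems only, no additional named fact).  No label change.
[cite: SerreInventiones1972, §1.12 (Cor. of Prop. 13), §2.4 Prop. 15]
[cite: EmertonPollackWeston2006, Thm. 1, Thm. 3.1.1, Thm. 5.1.3, §3.1] [cite: Wan2015, Thm. 4]
[cite: SteinWuthrich2013, Thm. 6.1 (p. 20)] [cite: Wuthrich2014, Thm. 3 (p. 382) and Cor. 19 proof (p. 399)] -/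
theorem forall_bsdp_of_namedFacts_bdd_of_not_dvd
    (hHida : hida_exists_congruent_ordinary_newform_of_multiplicative)
    (hMTT : exists_isCycPAdicLFunctionWeightK)
    (h311 : thm311_cotorsion_weightK_member) (hT1a : thm1_muAlg_of_weightK_member)
    (hT2 : Wan2015.thm4_rational_weightK_member_of_bdd)
    (hT1b : thm513_transfer_from_weightK_member_of_bdd)
    (h61 : DeligneSerre1974.thm61_exists_adicGaloisRep) (h326 : Hida2000_thm326_ordinary)
    (hKato : kato_charIdeal_dvd_multiplicative_of_surjective)
    (hJs : thm61_splitMultiplicative) (hJn : thm61_nonsplitMultiplicative)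
    (hHs : exists_isSplitMultCanonical) (hHn : exists_isMultCanonical)
    (hGZK : rank_eq_analyticRank_of_analyticRank_le_one) (hmod : hasEntireLFunction_rat)
    (hpar : nonempty_modularParametrizationData)
    (hGS : ∀ (W : WeierstrassCurve ℚ) [W.IsElliptic] [W.IsGloballyMinimal] (p : ℕ) [Fact p.Prime],
      greenberg_stevens (W := W) (p := p)) :
    ∀ (W : WeierstrassCurve ℚ) [W.IsElliptic] [W.IsGloballyMinimal] (p : ℕ) [Fact p.Prime],
      ClassX11a W p → 5 ≤ p → ¬ p ∣ padicValInt p W.minimalDiscriminantInt →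
        MuAnZeroAt W p → BSDp W p := by
  intro W _ _ p _ hX h5 hn hμ
  exact forall_bsdp_of_namedFacts_bdd hHida hMTT h311 hT1a hT2 hT1b h61 h326 hKato hJs hJn hHs hHn hGZK
    hmod hpar hGS W p hX h5 (ClassX11a.surj_of_not_dvd W p hX hn) hμ

/-- (Successor of `forall_bsdp_of_namedFacts_of_eleven_le` on the print-faithful BOUNDED Wan / EPW facts —
2026-08-20 repair; same proof.)
**X11a ∩ {`p ≥ 11`}: `BSD(E,p)` ⇐ NAMED PUBLISHED FACTS + the per-pair certificate
`μ^an(E,p) = 0`, with NO hypothesis on the image of `ρ̄_{E,p}`** — x11a's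
`forall_bsdp_of_namedFacts_bdd` with its `Surj W p` binder supplied by
`ClassX11a.surj_of_eleven_le` (at a multiplicative `p ≥ 11`, `E[p]` irreducible ⟹ `ρ̄_{E,p}` onto;
one more named fact `hB` = BDMTV 2019 Thm. 1.2 / Bilu–Parent–Rebolledo 2013 Cor. 1.2).  No label
change. [cite: BalakrishnanEtAl2019, §1 Thm. 1.2 (arXiv:1711.05846 p. 2)]
[cite: EmertonPollackWeston2006, Thm. 1, Thm. 3.1.1, Thm. 5.1.3, §3.1] [cite: Wan2015, Thm. 4]
[cite: SteinWuthrich2013, Thm. 6.1 (p. 20)] [cite: Wuthrich2014, Thm. 3 (p. 382) and Cor. 19 proof (p. 399)] -/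
theorem forall_bsdp_of_namedFacts_bdd_of_eleven_le
    (hHida : hida_exists_congruent_ordinary_newform_of_multiplicative)
    (hMTT : exists_isCycPAdicLFunctionWeightK)
    (h311 : thm311_cotorsion_weightK_member) (hT1a : thm1_muAlg_of_weightK_member)
    (hT2 : Wan2015.thm4_rational_weightK_member_of_bdd)
    (hT1b : thm513_transfer_from_weightK_member_of_bdd)
    (h61 : DeligneSerre1974.thm61_exists_adicGaloisRep) (h326 : Hida2000_thm326_ordinary)
    (hKato : kato_charIdeal_dvd_multiplicative_of_surjective)
    (hJs : thm61_splitMultiplicative) (hJn : thm61_nonsplitMultiplicative)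
    (hHs : exists_isSplitMultCanonical) (hHn : exists_isMultCanonical)
    (hGZK : rank_eq_analyticRank_of_analyticRank_le_one) (hmod : hasEntireLFunction_rat)
    (hpar : nonempty_modularParametrizationData)
    (hGS : ∀ (W : WeierstrassCurve ℚ) [W.IsElliptic] [W.IsGloballyMinimal] (p : ℕ) [Fact p.Prime],
      greenberg_stevens (W := W) (p := p))
    (hB : thm12_not_le_normalizer_splitCartan) :
    ∀ (W : WeierstrassCurve ℚ) [W.IsElliptic] [W.IsGloballyMinimal] (p : ℕ) [Fact p.Prime],
      ClassX11a W p → 11 ≤ p → MuAnZeroAt W p → BSDp W p := by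
  intro W _ _ p _ hX h11 hμ
  exact forall_bsdp_of_namedFacts_bdd hHida hMTT h311 hT1a hT2 hT1b h61 h326 hKato hJs hJn hHs hHn hGZK
    hmod hpar hGS W p hX (by omega) (ClassX11a.surj_of_eleven_le W p hB hX h11) hμ

/-- (Successor of `forall_bsdp_of_namedFacts_mtt` on the print-faithful BOUNDED Wan / EPW facts —
2026-08-20 repair; same proof.)
**X11a ∩ {`p ≥ 5`, `ρ̄_{E,p}` surjective}: `BSD(E,p)` ⇐ 16 NAMED PUBLISHED FACTS + the
per-pair certificate `μ^an(E,p) = 0`** — `forall_bsdp_of_namedFacts_bdd` with its Mazur–Tate–Teitelbaum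
binder `hMTT` supplied by the tree theorem `exists_isCycPAdicLFunctionWeightK_holds`.
[cite: MazurTateTeitelbaum1986Invent, §I.11 and §I.14 (14.3)]
[cite: EmertonPollackWeston2006, Thm. 1, Thm. 3.1.1, Thm. 5.1.3, §3.1] [cite: Wan2015, Thm. 4]
[cite: SteinWuthrich2013, Thm. 6.1 (p. 20)] [cite: Wuthrich2014, Thm. 3 (p. 382) and Cor. 19 proof (p. 399)] -/
theorem forall_bsdp_of_namedFacts_bdd_mtt
    (hHida : hida_exists_congruent_ordinary_newform_of_multiplicative)
    (h311 : thm311_cotorsion_weightK_member) (hT1a : thm1_muAlg_of_weightK_member)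
    (hT2 : Wan2015.thm4_rational_weightK_member_of_bdd)
    (hT1b : thm513_transfer_from_weightK_member_of_bdd)
    (h61 : DeligneSerre1974.thm61_exists_adicGaloisRep) (h326 : Hida2000_thm326_ordinary)
    (hKato : kato_charIdeal_dvd_multiplicative_of_surjective)
    (hJs : thm61_splitMultiplicative) (hJn : thm61_nonsplitMultiplicative)
    (hHs : exists_isSplitMultCanonical) (hHn : exists_isMultCanonical)
    (hGZK : rank_eq_analyticRank_of_analyticRank_le_one) (hmod : hasEntireLFunction_rat)
    (hpar : nonempty_modularParametrizationData)
    (hGS : ∀ (W : WeierstrassCurve ℚ) [W.IsElliptic] [W.IsGloballyMinimal] (p : ℕ) [Fact p.Prime],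
      greenberg_stevens (W := W) (p := p)) :
    ∀ (W : WeierstrassCurve ℚ) [W.IsElliptic] [W.IsGloballyMinimal] (p : ℕ) [Fact p.Prime],
      ClassX11a W p → 5 ≤ p → Surj W p → MuAnZeroAt W p → BSDp W p :=
  forall_bsdp_of_namedFacts_bdd hHida exists_isCycPAdicLFunctionWeightK_holds h311 hT1a hT2 hT1b h61 h326
    hKato hJs hJn hHs hHn hGZK hmod hpar hGS

/-- (Successor of `forall_bsdp_of_namedFacts_mtt_of_eleven_le` on the print-faithful BOUNDED Wan / EPW facts —
2026-08-20 repair; same proof.)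
**X11a ∩ {`p ≥ 11`}: `BSD(E,p)` ⇐ 17 NAMED PUBLISHED FACTS + the per-pair certificate, with NO
hypothesis on the image of `ρ̄_{E,p}`** — x11c's `forall_bsdp_of_namedFacts_bdd_of_eleven_le` with
`hMTT` supplied by `exists_isCycPAdicLFunctionWeightK_holds`.
[cite: MazurTateTeitelbaum1986Invent, §I.11 and §I.14 (14.3)]
[cite: BalakrishnanEtAl2019, §1 Thm. 1.2 (arXiv:1711.05846 p. 2)] -/
theorem forall_bsdp_of_namedFacts_bdd_mtt_of_eleven_le
    (hHida : hida_exists_congruent_ordinary_newform_of_multiplicative)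
    (h311 : thm311_cotorsion_weightK_member) (hT1a : thm1_muAlg_of_weightK_member)
    (hT2 : Wan2015.thm4_rational_weightK_member_of_bdd)
    (hT1b : thm513_transfer_from_weightK_member_of_bdd)
    (h61 : DeligneSerre1974.thm61_exists_adicGaloisRep) (h326 : Hida2000_thm326_ordinary)
    (hKato : kato_charIdeal_dvd_multiplicative_of_surjective)
    (hJs : thm61_splitMultiplicative) (hJn : thm61_nonsplitMultiplicative)
    (hHs : exists_isSplitMultCanonical) (hHn : exists_isMultCanonical)
    (hGZK : rank_eq_analyticRank_of_analyticRank_le_one) (hmod : hasEntireLFunction_rat)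
    (hpar : nonempty_modularParametrizationData)
    (hGS : ∀ (W : WeierstrassCurve ℚ) [W.IsElliptic] [W.IsGloballyMinimal] (p : ℕ) [Fact p.Prime],
      greenberg_stevens (W := W) (p := p))
    (hB : thm12_not_le_normalizer_splitCartan) :
    ∀ (W : WeierstrassCurve ℚ) [W.IsElliptic] [W.IsGloballyMinimal] (p : ℕ) [Fact p.Prime],
      ClassX11a W p → 11 ≤ p → MuAnZeroAt W p → BSDp W p :=
  forall_bsdp_of_namedFacts_bdd_of_eleven_le hHida exists_isCycPAdicLFunctionWeightK_holds h311 hT1a hT2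
    hT1b h61 h326 hKato hJs hJn hHs hHn hGZK hmod hpar hGS hB

/-- (Successor of `forall_bsdp_of_namedFacts_mtt_of_not_dvd` on the print-faithful BOUNDED Wan / EPW facts —
2026-08-20 repair; same proof.)
**X11a ∩ {`p ≥ 5`, `p ∤ ord_p(Δ_min)`}: `BSD(E,p)` ⇐ 16 NAMED PUBLISHED FACTS + the per-pair
certificate, with NO hypothesis on the image of `ρ̄_{E,p}` and no extra named fact** — x11c's
`forall_bsdp_of_namedFacts_bdd_of_not_dvd` (`Surj` from the integer check `p ∤ ord_p Δ_min`, Serre 1972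
§1.12 / §2.4, tree theorems) with `hMTT` supplied by `exists_isCycPAdicLFunctionWeightK_holds`.
[cite: MazurTateTeitelbaum1986Invent, §I.11 and §I.14 (14.3)]
[cite: SerreInventiones1972, §1.12 (Cor. of Prop. 13), §2.4 Prop. 15] -/
theorem forall_bsdp_of_namedFacts_bdd_mtt_of_not_dvd
    (hHida : hida_exists_congruent_ordinary_newform_of_multiplicative)
    (h311 : thm311_cotorsion_weightK_member) (hT1a : thm1_muAlg_of_weightK_member)
    (hT2 : Wan2015.thm4_rational_weightK_member_of_bdd)
    (hT1b : thm513_transfer_from_weightK_member_of_bdd)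
    (h61 : DeligneSerre1974.thm61_exists_adicGaloisRep) (h326 : Hida2000_thm326_ordinary)
    (hKato : kato_charIdeal_dvd_multiplicative_of_surjective)
    (hJs : thm61_splitMultiplicative) (hJn : thm61_nonsplitMultiplicative)
    (hHs : exists_isSplitMultCanonical) (hHn : exists_isMultCanonical)
    (hGZK : rank_eq_analyticRank_of_analyticRank_le_one) (hmod : hasEntireLFunction_rat)
    (hpar : nonempty_modularParametrizationData)
    (hGS : ∀ (W : WeierstrassCurve ℚ) [W.IsElliptic] [W.IsGloballyMinimal] (p : ℕ) [Fact p.Prime],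
      greenberg_stevens (W := W) (p := p)) :
    ∀ (W : WeierstrassCurve ℚ) [W.IsElliptic] [W.IsGloballyMinimal] (p : ℕ) [Fact p.Prime],
      ClassX11a W p → 5 ≤ p → ¬ p ∣ padicValInt p W.minimalDiscriminantInt →
        MuAnZeroAt W p → BSDp W p :=
  forall_bsdp_of_namedFacts_bdd_of_not_dvd hHida exists_isCycPAdicLFunctionWeightK_holds h311 hT1a hT2
    hT1b h61 h326 hKato hJs hJn hHs hHn hGZK hmod hpar hGS

end Summit.BirchSwinnertonDyer.Rank1Residual.X11a

end
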